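import Summits.ResolutionOfSingularities.ResolutionOfSingularities.Theorems.PurelyInseparableDim4WidePlanar
import Summits.ResolutionOfSingularities.ResolutionOfSingularities.Theorems.PurelyInseparableDim4NarrowDrop
import Summits.ResolutionOfSingularities.ResolutionOfSingularities.Theorems.PurelyInseparableDim4NarrowCurvilinear
import HarnessLib

/-!
# [OURS · res-dim4-pi] THE LEVEL-2 DICTIONARY ROW `d₂ = 1 + ē`: the second value of the `μ⁺`-staircase
  is one plus the ridge dimension (for `ē ≤ 2`)

Cell `res-dim4-pi` (D-0157 DOOR 2), seat `res-dim4-p-3` (g2); fifth file of the wide-core letter kit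
(`…JetColength` p661642/p661862 · `…JetOrder` p662591 · `…JetOrderStaircase` p663052/p663270 ·
`…WidePlanar` p663672).  The two letter systems of the cell's F4-I(p,p) work are idea-3's ridge letter
`ē(F) = dim_K A(in F)` (`RidgeBudget.ebar`, tree `Directrix.*`) and the Hilbert staircase
`d_N = dim_K A ⧸ (J_q⁺(F) + 𝔪₀ᴺ)` (`RidgeBudget.jetColength q N F`; `μ⁺ = d_N` for `N ≥ N⁺`, `o(F)` read off
`{k : d_k = k(k+1)/2}`).  This file proves the row linking them at level `2` for states of order exactly
`q ≥ 2` with `ē ≤ 2` (every cleaned floor state, `Directrix`/p-5 `DirectrixAtMostTwo`):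
**`d₂ = 1 + ē`** — so «narrow ⟺ d₂ = 2», «wide ⟺ d₂ = 3 ⟺ 2 ≤ o(F)», «ē = 0 ⟺ d₂ = 1».
Upper bounds are the span lemmas (p-3 g2) fed by apolarity (p-1 g2 `NarrowApolarity.*`); lower bounds
are independence of the classes of `1, x_a (, x_b)` modulo `J_q⁺(F) + 𝔪₀²`, by p-1 g2's
`NarrowApolarity.sum_coeff_single_mul_eq_zero` (linear parts of `J⁺ + 𝔪²` kill the ridge).

* §1 bookkeeping: `constantCoeff_eq_zero_of_mem_sup_sq`, `coeff_single_smul_X`,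
  `sum_coeff_single_pair`, `le_finrank_quotient_of_forall` (an independent family of classes bounds
  `d` below).
* §2 `jetColength_two_le_of_finrank_le_two`, `jetColength_two_ge`, **`jetColength_two_eq`**
  (`d₂ = 1 + ē` for `ē ≤ 2`), `jetColength_two_eq_three_iff` («wide ⟺ d₂ = 3»).

[OURS · counted 0 · elementary linear algebra; AI kernel work, weaker than expert review.]  Nothing here
is a statement about resolution of singularities; nothing here proves `NoWideTrap` / `E2(3,3)`;
resolution in dimension `≥ 4` / characteristic `p > 0` is NOT proved by anything in this file.  Host item
(DR-157-C): `stmt-ResolutionOfSingularities-16155`, helper.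
-/

noncomputable section

set_option linter.dupNamespace false -- mandated namespace of this single-conjunct summit

open MvPolynomial Finset
open scoped BigOperators

namespace Summit.ResolutionOfSingularities.ResolutionOfSingularities.Theorems.PIDim4.RidgeBudget

open IsolationCert
open Literature.AlgebraicGeometry.Resolution
open Literature.AlgebraicGeometry.Resolution.Hauser2010
open Literature.AlgebraicGeometry.Resolution.HauserPerlega2019
open Literature.Barriers.ResolutionOfSingularities
open PointBlowup (gradSpan additiveSubspace)

variable {K : Type} [Field K]

/-! ## §1 Bookkeeping: constant and linear coefficients of test elements -/

/-- Elements of `J + 𝔪₀²` with `J ≤ 𝔪₀` have no constant term. OURS (bookkeeping).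
[cite: AtiyahMacdonald1969, Ch. 1 Ex. 1.1 (the ideal (x₁,…,xₙ))] -/
theorem constantCoeff_eq_zero_of_mem_sup_sq {J : Ideal (MvPolynomial (Fin 4) K)}
    (hJ : J ≤ originIdeal K) {G : MvPolynomial (Fin 4) K} (hG : G ∈ J ⊔ originIdeal K ^ 2) :
    constantCoeff G = 0 := by
  have hle : J ⊔ originIdeal K ^ 2 ≤ originIdeal K :=
    sup_le hJ (Ideal.pow_le_self two_ne_zero)
  exact (NarrowApolarity.mem_originIdeal_iff G).mp (hle hG)

/-- `coeff_{e_i} (g · x_a) = g · [a = i]`. OURS (bookkeeping). [folklore] -/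
theorem coeff_single_smul_X (g : K) (a i : Fin 4) :
    coeff (Finsupp.single i 1) (g • (X a : MvPolynomial (Fin 4) K)) = if a = i then g else 0 := by
  classical
  simp only [coeff_smul, coeff_X, Finsupp.single_left_inj one_ne_zero, smul_eq_mul, mul_ite,
    mul_one, mul_zero]

/-- The linear functional of `c + g₁ x_a + g₂ x_b` evaluated on a vector `w`: `g₁ w_a + g₂ w_b`.
OURS (bookkeeping). [folklore] -/
theorem sum_coeff_single_pair (c g₁ g₂ : K) (a b : Fin 4) (w : Fin 4 → K) :
    ∑ i, coeff (Finsupp.single i 1)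
        (C c + g₁ • (X a : MvPolynomial (Fin 4) K) + g₂ • (X b : MvPolynomial (Fin 4) K)) * w i =
      g₁ * w a + g₂ * w b := by
  have h0 : ∀ x : Fin 4, (0 : Fin 4 →₀ ℕ) ≠ Finsupp.single x 1 := fun x =>
    (Finsupp.single_ne_zero.mpr one_ne_zero).symm
  simp only [coeff_add, coeff_C, h0, if_false, coeff_single_smul_X, add_mul, ite_mul, zero_mul,
    zero_add, Finset.sum_add_distrib, Finset.sum_ite_eq, Finset.mem_univ, if_true]

/-- **Independent classes bound the colength below.** If `𝔪₀² ≤ I` and for a finite family `v` every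
`K`-relation `Σ gᵢ vᵢ ∈ I` is trivial, then `card ι ≤ dim_K A ⧸ I`. OURS (linear algebra).
[cite: AtiyahMacdonald1969, Prop. 6.9 (length is additive)] -/
theorem le_finrank_quotient_of_forall {ι : Type} [Fintype ι] {I : Ideal (MvPolynomial (Fin 4) K)}
    {n : ℕ} (hI : originIdeal K ^ n ≤ I) (v : ι → MvPolynomial (Fin 4) K)
    (h : ∀ g : ι → K, (∑ i, g i • v i) ∈ I → ∀ i, g i = 0) :
    Fintype.card ι ≤ Module.finrank K (MvPolynomial (Fin 4) K ⧸ I) := by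
  haveI : Module.Finite K (MvPolynomial (Fin 4) K ⧸ I) :=
    moduleFinite_quotient_of_originIdeal_pow_le hI
  exact ((linearIndependent_mk_iff v).mpr h).fintype_card_le_finrank

/-! ## §2 `d₂ = 1 + ē` -/

/-- **Upper bound `d₂ ≤ 1 + ē` (ē ≤ 2).** Cases: `ē = 0` — `𝔪₀ ≤ J⁺ + 𝔪₀²`
(`NarrowApolarity.originIdeal_le_sup_of_additiveSubspace_eq_bot`) and the `ē = 0` span twin; `ē = 1` —
curvilinear along a ridge coordinate (`NarrowApolarity.originIdeal_le_span_X_sup`) and the span lemma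
with `x_j² ∈ 𝔪₀²`; `ē = 2` — the plane bound at `N = 2`. OURS (linear algebra).
[cite: AtiyahMacdonald1969, Prop. 6.9 (length is additive)] -/
theorem jetColength_two_le_of_finrank_le_two {q : ℕ} (hq : 2 ≤ q) {F : MvPolynomial (Fin 4) K}
    (hord : ordZero F = q) (he : Module.finrank K (additiveSubspace (initialForm F)) ≤ 2) :
    jetColength q 2 F ≤ 1 + Module.finrank K (additiveSubspace (initialForm F)) := by
  rcases Nat.lt_or_ge (Module.finrank K (additiveSubspace (initialForm F))) 1 with h0 | h1
  · -- `ē = 0`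
    have h0' : Module.finrank K (additiveSubspace (initialForm F)) = 0 := by omega
    have hbot : additiveSubspace (initialForm F) = ⊥ := Submodule.finrank_eq_zero.mp h0'
    rw [h0']
    exact finrank_quotient_le_one_of_le_sup_sq
      (NarrowApolarity.originIdeal_le_sup_of_additiveSubspace_eq_bot hq hord hbot) 2
  rcases Nat.lt_or_ge (Module.finrank K (additiveSubspace (initialForm F))) 2 with h1' | h2
  · -- `ē = 1`
    have he1 : Module.finrank K (additiveSubspace (initialForm F)) = 1 := by omega
    obtain ⟨w, hw, hw0⟩ : ∃ w ∈ additiveSubspace (initialForm F), w ≠ 0 := by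
      by_contra h
      push Not at h
      have : additiveSubspace (initialForm F) = ⊥ := (Submodule.eq_bot_iff _).mpr h
      rw [this, finrank_bot] at he1
      exact zero_ne_one he1
    obtain ⟨j, hwj⟩ : ∃ j, w j ≠ 0 := by
      by_contra h
      push Not at h
      exact hw0 (funext h)
    rw [he1]
    refine finrank_quotient_le_of_X_pow_mem
      (NarrowApolarity.originIdeal_le_span_X_sup hq hord he1 hw hwj)
      (Ideal.mem_sup_right (Ideal.pow_mem_pow (IsolatedScope.X_mem_originIdeal j) 2))
  · -- `ē = 2`
    have he2 : Module.finrank K (additiveSubspace (initialForm F)) = 2 := le_antisymm he h2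
    rw [he2]
    exact jetColength_le_triangle_of_finrank_le_two hq hord he 2

/-- **Lower bound `1 + ē ≤ d₂` (ē ≤ 2):** the classes of `1`, and of the coordinates of a separating
pair that is a coordinate system on the ridge, are independent modulo `J_q⁺(F) + 𝔪₀²` — a relation
`c + g₁x_a + g₂x_b ∈ J⁺ + 𝔪₀²` has `c = 0` (no constant terms) and `g₁w_a + g₂w_b = 0` for every ridge
vector `w` (p-1 g2's `NarrowApolarity.sum_coeff_single_mul_eq_zero`). OURS (linear algebra).
[cite: BerthomieuHivertMourtada2010, Cor. 2.3] -/
theorem jetColength_two_ge {q : ℕ} {F : MvPolynomial (Fin 4) K}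
    (hord : ordZero F = q) (he : Module.finrank K (additiveSubspace (initialForm F)) ≤ 2) :
    1 + Module.finrank K (additiveSubspace (initialForm F)) ≤ jetColength q 2 F := by
  classical
  have hJ : singLocusIdeal q F ≤ originIdeal K := singLocusIdeal_le_originIdeal_of_ordZero_eq hord
  set W := additiveSubspace (initialForm F) with hWdef
  -- a separating pair `(a, b)`: `u ↦ (u_a, u_b)` is injective on `W`
  obtain ⟨a, b, hab, hsep⟩ := exists_pair_separating_of_finrank_le_two he
  let π : W →ₗ[K] (Fin 2 → K) :=
    { toFun := fun u => ![(u : Fin 4 → K) a, (u : Fin 4 → K) b]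
      map_add' := fun u v => by
        ext i; fin_cases i <;> simp
      map_smul' := fun c u => by
        ext i; fin_cases i <;> simp }
  have hπ : Function.Injective π := by
    intro u v huv
    have ha : (u : Fin 4 → K) a = (v : Fin 4 → K) a := by
      have := congrFun huv 0; simpa [π] using this
    have hb : (u : Fin 4 → K) b = (v : Fin 4 → K) b := by
      have := congrFun huv 1; simpa [π] using this
    have h0 := hsep ((u : Fin 4 → K) - v) (W.sub_mem u.2 v.2)
      (by rw [Pi.sub_apply, ha, sub_self]) (by rw [Pi.sub_apply, hb, sub_self])
    exact Subtype.ext (sub_eq_zero.mp h0)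
  -- the test family: `1` and the first `ē` of `x_a, x_b`
  have key : ∀ (c g₁ g₂ : K),
      C c + g₁ • (X a : MvPolynomial (Fin 4) K) + g₂ • (X b : MvPolynomial (Fin 4) K) ∈
        singLocusIdeal q F ⊔ originIdeal K ^ 2 →
      c = 0 ∧ ∀ w ∈ W, g₁ * w a + g₂ * w b = 0 := by
    intro c g₁ g₂ hG
    refine ⟨?_, fun w hw => ?_⟩
    · have := constantCoeff_eq_zero_of_mem_sup_sq hJ hG
      simpa [smul_eq_C_mul, constantCoeff_X] using this
    · rw [← sum_coeff_single_pair c g₁ g₂ a b w]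
      exact NarrowApolarity.sum_coeff_single_mul_eq_zero hord hw hG
  -- dimension count: `finrank W` independent coordinate values are available through `π`
  rcases Nat.lt_or_ge (Module.finrank K W) 1 with h0 | h1
  · -- `ē = 0`: the class of `1`
    have h0' : Module.finrank K W = 0 := by omega
    rw [h0', add_zero]
    have := le_finrank_quotient_of_forall (I := singLocusIdeal q F ⊔ originIdeal K ^ 2) (n := 2)
      le_sup_right (fun _ : Fin 1 => (1 : MvPolynomial (Fin 4) K)) fun g hg i => by
        have h := (key (g 0) 0 0 (by simpa [smul_eq_C_mul] using hg)).1
        fin_cases i; exact h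
    simpa [jetColength] using this
  rcases Nat.lt_or_ge (Module.finrank K W) 2 with h1' | h2
  · -- `ē = 1`: some `w ∈ W` with `w_a ≠ 0` or `w_b ≠ 0`
    have he1 : Module.finrank K W = 1 := by omega
    obtain ⟨w, hw, hw0⟩ : ∃ w ∈ W, w ≠ 0 := by
      by_contra h
      push Not at h
      have : W = ⊥ := (Submodule.eq_bot_iff _).mpr h
      rw [this, finrank_bot] at he1
      exact zero_ne_one he1
    have hwab : w a ≠ 0 ∨ w b ≠ 0 := by
      by_contra h
      push Not at h
      exact hw0 (hsep w hw h.1 h.2)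
    rw [he1]
    rcases hwab with hwa | hwb
    · have := le_finrank_quotient_of_forall (I := singLocusIdeal q F ⊔ originIdeal K ^ 2) (n := 2)
        le_sup_right ![(1 : MvPolynomial (Fin 4) K), X a] fun g hg => by
          rw [Fin.sum_univ_two] at hg
          simp only [Matrix.cons_val_zero, Matrix.cons_val_one] at hg
          have hk := key (g 0) (g 1) 0 (by simpa [smul_eq_C_mul] using hg)
          have h1 : g 1 = 0 := by
            have := hk.2 w hw
            rw [zero_mul, add_zero] at this
            exact (mul_eq_zero.mp this).resolve_right hwa
          intro i; fin_cases i
          · exact hk.1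
          · exact h1
      simpa [jetColength] using this
    · have := le_finrank_quotient_of_forall (I := singLocusIdeal q F ⊔ originIdeal K ^ 2) (n := 2)
        le_sup_right ![(1 : MvPolynomial (Fin 4) K), X b] fun g hg => by
          rw [Fin.sum_univ_two] at hg
          simp only [Matrix.cons_val_zero, Matrix.cons_val_one] at hg
          have hk := key (g 0) 0 (g 1) (by simpa [smul_eq_C_mul] using hg)
          have h1 : g 1 = 0 := by
            have := hk.2 w hw
            rw [zero_mul, zero_add] at this
            exact (mul_eq_zero.mp this).resolve_right hwb
          intro i; fin_cases i
          · exact hk.1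
          · exact h1
      simpa [jetColength] using this
  · -- `ē = 2`: `π` is bijective, so `W` contains vectors with `(w_a, w_b) = (1, 0)` and `(0, 1)`
    have he2 : Module.finrank K W = 2 := le_antisymm he h2
    have hsurj : Function.Surjective π := by
      have hdim : Module.finrank K W = Module.finrank K (Fin 2 → K) := by
        rw [he2, Module.finrank_fin_fun]
      exact (LinearMap.injective_iff_surjective_of_finrank_eq_finrank hdim).mp hπ
    obtain ⟨u₁, hu₁⟩ := hsurj ![1, 0]
    obtain ⟨u₂, hu₂⟩ := hsurj ![0, 1]
    have hu₁a : (u₁ : Fin 4 → K) a = 1 := by have := congrFun hu₁ 0; simpa [π] using this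
    have hu₁b : (u₁ : Fin 4 → K) b = 0 := by have := congrFun hu₁ 1; simpa [π] using this
    have hu₂a : (u₂ : Fin 4 → K) a = 0 := by have := congrFun hu₂ 0; simpa [π] using this
    have hu₂b : (u₂ : Fin 4 → K) b = 1 := by have := congrFun hu₂ 1; simpa [π] using this
    rw [he2]
    have := le_finrank_quotient_of_forall (I := singLocusIdeal q F ⊔ originIdeal K ^ 2) (n := 2)
      le_sup_right ![(1 : MvPolynomial (Fin 4) K), X a, X b] fun g hg => by
        rw [Fin.sum_univ_three] at hg
        simp only [Matrix.cons_val_zero, Matrix.cons_val_one, Matrix.cons_val_two, Matrix.head_cons,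
          Matrix.tail_cons] at hg
        have hk := key (g 0) (g 1) (g 2) (by simpa [smul_eq_C_mul] using hg)
        have h1 : g 1 = 0 := by
          have := hk.2 u₁ u₁.2
          rwa [hu₁a, hu₁b, mul_one, mul_zero, add_zero] at this
        have h2' : g 2 = 0 := by
          have := hk.2 u₂ u₂.2
          rwa [hu₂a, hu₂b, mul_zero, mul_one, zero_add] at this
        intro i; fin_cases i
        · exact hk.1
        · exact h1
        · exact h2'
    simpa [jetColength] using this

/-- **THE LEVEL-2 ROW `d₂ = 1 + ē`** for states of order exactly `q ≥ 2` with `ē ≤ 2` (all cleaned floor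
states): `jetColength q 2 F = 1 + dim_K A(in F)`.  Hence «ē = 0 ⟺ d₂ = 1», «narrow ⟺ d₂ = 2»,
«wide ⟺ d₂ = 3 ⟺ 2 ≤ o(F)». OURS (linear algebra). [cite: BerthomieuHivertMourtada2010, Cor. 2.3] -/
theorem jetColength_two_eq {q : ℕ} (hq : 2 ≤ q) {F : MvPolynomial (Fin 4) K} (hord : ordZero F = q)
    (he : Module.finrank K (additiveSubspace (initialForm F)) ≤ 2) :
    jetColength q 2 F = 1 + Module.finrank K (additiveSubspace (initialForm F)) :=
  le_antisymm (jetColength_two_le_of_finrank_le_two hq hord he) (jetColength_two_ge hord he)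

/-- **«wide ⟺ d₂ = 3»** at order exactly `q ≥ 2` with `ē ≤ 2`: `ebar F = 2 ↔ jetColength q 2 F = 3`
(`= 2·3/2`, the level-2 triangle number: `2 ≤ o(F)`). OURS (linear algebra).
[cite: BerthomieuHivertMourtada2010, Cor. 2.3] -/
theorem ebar_eq_two_iff_jetColength_two_eq_three {q : ℕ} (hq : 2 ≤ q) {F : MvPolynomial (Fin 4) K}
    (hord : ordZero F = q) (he : ebar F ≤ 2) : ebar F = 2 ↔ jetColength q 2 F = 3 := by
  have h := jetColength_two_eq hq hord he
  unfold ebar at he ⊢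
  omega

end Summit.ResolutionOfSingularities.ResolutionOfSingularities.Theorems.PIDim4.RidgeBudget

end
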